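import Summits.CriticalPhenomena.PercolationContinuityZ3.Theorems.SahiCMTP2Basic

/-!
# Density-free cMTP₂ (Fuchs–Wang 2026, (5.1)): block maps, replacement, marginalisation

Support file of the Sahi cell (`prim-sahi`, typer seat, generation 18; `--supports stmt-CriticalPhenomena-4575`).
Theorems only (no definitions, no named facts, no sorries).

The density-free counterparts of [FuchsWang2026] Thm. 2.3 ("replacement": `cMTP₂(X_B|X_A) ⇒ cMTP₂(X_{B∪{k}}|X_{A∖{k}})`),
Cor. 2.4 (closure under marginalisation in `A` and in `B`) and of the invariance axioms B4/B5 of Colangelo–Müller–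
Scarsini, for the notion (5.1) (`IsCMTP2Set`).  In the paper these need densities and Lemma A.1; density-free each is a
preimage computation plus a lattice inclusion:

* `isCMTP2Set_map_prodMap` — push-forward along `Prod.map φ ψ` with `φ` a measurable LATTICE HOMOMORPHISM of the first
  block and `ψ` a measurable LOWER ADJOINT of the second block (`ψ y ≤ y' ↔ y ≤ χ y'`, e.g. an order isomorphism):
  coordinate permutations inside the blocks, coordinatewise increasing bijections, … (B4/B5-type invariance).
* `isCMTP2Set_map_fst_left` — marginalisation in the first block (Cor. 2.4, `A' ⊆ A`): `φ = Prod.fst` is a lattice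
  homomorphism.
* `isCMTP2Set_map_prodAssoc` — **replacement (Thm. 2.3)**: moving a sub-block `Z` from the conditioning block to the
  conditioned block, `(X' × Z) × Y → X' × (Z × Y)`, preserves (5.1).
* `isCMTP2Set_map_fst_right_of_orderTop`, `isCMTP2Set_map_fst_right` — marginalisation in the second block (Cor. 2.4,
  `B' ⊆ B`), with a top element resp. along a cofinal sequence of the dropped factor (e.g. `ℝ^k`).

No sorries, no new axioms.  References: [FuchsWang2026] Thm. 2.3, Cor. 2.4, Rem. 2.10; [ColangeloMullerScarsini2006]
Thm. 3 (B4, B5, B7); the density-free statements are this work.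
-/

noncomputable section

namespace Summit.CriticalPhenomena.PercolationContinuityZ3.Theorems.SahiCMTP2

open MeasureTheory Set Filter Topology Function
open Literature.Probability.LatticeModels Literature.Probability.LatticeModels.Affiliation
open Summit.CriticalPhenomena.PercolationContinuityZ3.Theorems.SahiBoxTP2 (measure_mul_le_of_monotone_iUnion)
open scoped ENNReal SetFamily

section Maps

variable {X X' Y Y' : Type*} [MeasurableSpace X] [MeasurableSpace X'] [MeasurableSpace Y] [MeasurableSpace Y']
  [Lattice X] [Lattice X'] [Lattice Y] [Lattice Y']

omit [MeasurableSpace X] [MeasurableSpace X'] in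
/-- Preimages of images under a lattice homomorphism: `φ⁻¹C ∧ φ⁻¹D ⊆ φ⁻¹(C ∧ D)`. [folklore] -/
theorem preimage_infs_subset_of_map_inf {φ : X → X'} (hinf : ∀ a b, φ (a ⊓ b) = φ a ⊓ φ b) (C D : Set X') :
    (φ ⁻¹' C) ⊼ (φ ⁻¹' D) ⊆ φ ⁻¹' (C ⊼ D) :=
  Set.infs_subset_iff.2 fun a ha b hb => by
    show φ (a ⊓ b) ∈ C ⊼ D
    rw [hinf]; exact Set.mem_infs.2 ⟨φ a, ha, φ b, hb, rfl⟩

omit [MeasurableSpace X] [MeasurableSpace X'] in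
/-- Dually `φ⁻¹C ∨ φ⁻¹D ⊆ φ⁻¹(C ∨ D)`. [folklore] -/
theorem preimage_sups_subset_of_map_sup {φ : X → X'} (hsup : ∀ a b, φ (a ⊔ b) = φ a ⊔ φ b) (C D : Set X') :
    (φ ⁻¹' C) ⊻ (φ ⁻¹' D) ⊆ φ ⁻¹' (C ⊻ D) :=
  Set.sups_subset_iff.2 fun a ha b hb => by
    show φ (a ⊔ b) ∈ C ⊻ D
    rw [hsup]; exact Set.mem_sups.2 ⟨φ a, ha, φ b, hb, rfl⟩

omit [MeasurableSpace X] [MeasurableSpace X'] [MeasurableSpace Y] [MeasurableSpace Y'] [Lattice X] [Lattice X']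
  [Lattice Y] [Lattice Y'] in
/-- Preimage of a conditional-orthant event under a block map whose second component is a lower adjoint:
`(φ × ψ)⁻¹(S × (−∞,y']) = φ⁻¹S × (−∞, χ y']`. [folklore] -/
theorem preimage_prodMap_prod_Iic [Preorder Y] [Preorder Y'] (φ : X → X') {ψ : Y → Y'} {χ : Y' → Y}
    (hgc : GaloisConnection ψ χ) (S : Set X') (y' : Y') :
    Prod.map φ ψ ⁻¹' (S ×ˢ Iic y') = (φ ⁻¹' S) ×ˢ Iic (χ y') := by
  ext p
  simp only [mem_preimage, mem_prod, mem_Iic, Prod.map_fst, Prod.map_snd]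
  exact and_congr Iff.rfl (hgc p.2 y')

/-- **(5.1) is preserved by block maps** `(X_A, X_B) ↦ (φ X_A, ψ X_B)` with `φ` a measurable lattice homomorphism of
the first block and `ψ` a measurable lower adjoint of the second block (`ψ y ≤ y' ↔ y ≤ χ y'`: then
`{ψ X_B ≤ y'} = {X_B ≤ χ y'}` and `χ` preserves `∧`; e.g. order isomorphisms, coordinate permutations inside the
blocks, coordinatewise increasing bijections of `ℝ`).  Density-free B4/B5-type invariance. [this work] -/
theorem isCMTP2Set_map_prodMap [TopologicalSpace Y'] [OpensMeasurableSpace Y'] [ClosedIicTopology Y']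
    {μ : Measure (X × Y)} (h : IsCMTP2Set μ) {φ : X → X'} (hφ : Measurable φ)
    (hinf : ∀ a b, φ (a ⊓ b) = φ a ⊓ φ b) (hsup : ∀ a b, φ (a ⊔ b) = φ a ⊔ φ b) {ψ : Y → Y'} (hψ : Measurable ψ)
    {χ : Y' → Y} (hgc : GaloisConnection ψ χ) :
    IsCMTP2Set (μ.map (Prod.map φ ψ)) := by
  intro C D hC hD y₁ y₂
  have hm : Measurable (Prod.map φ ψ) := hφ.prodMap hψ
  rw [Measure.map_apply hm (hC.prod measurableSet_Iic), Measure.map_apply hm (hD.prod measurableSet_Iic),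
    preimage_prodMap_prod_Iic φ hgc, preimage_prodMap_prod_Iic φ hgc]
  refine (h (hφ hC) (hφ hD) (χ y₁) (χ y₂)).trans (mul_le_mul' ?_ ?_)
  · calc μ ((φ ⁻¹' C ⊼ φ ⁻¹' D) ×ˢ Iic (χ y₁ ⊓ χ y₂))
        ≤ μ (Prod.map φ ψ ⁻¹' ((C ⊼ D) ×ˢ Iic (y₁ ⊓ y₂))) := by
          rw [preimage_prodMap_prod_Iic φ hgc, hgc.u_inf]
          exact measure_mono (prod_mono (preimage_infs_subset_of_map_inf hinf C D) Subset.rfl)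
      _ ≤ μ.map (Prod.map φ ψ) ((C ⊼ D) ×ˢ Iic (y₁ ⊓ y₂)) := Measure.le_map_apply hm.aemeasurable _
  · calc μ ((φ ⁻¹' C ⊻ φ ⁻¹' D) ×ˢ Iic (χ y₁ ⊔ χ y₂))
        ≤ μ (Prod.map φ ψ ⁻¹' ((C ⊻ D) ×ˢ Iic (y₁ ⊔ y₂))) := by
          rw [preimage_prodMap_prod_Iic φ hgc]
          exact measure_mono (prod_mono (preimage_sups_subset_of_map_sup hsup C D)
            (Iic_subset_Iic.2 (hgc.monotone_u.le_map_sup _ _)))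
      _ ≤ μ.map (Prod.map φ ψ) ((C ⊻ D) ×ˢ Iic (y₁ ⊔ y₂)) := Measure.le_map_apply hm.aemeasurable _

/-- **Marginalisation in the first block** ([FuchsWang2026] Cor. 2.4, `A' ⊆ A`, density-free): dropping a factor `Z` of
the conditioning block preserves (5.1) (`Prod.fst` is a lattice homomorphism). [this work] -/
theorem isCMTP2Set_map_fst_left {Z : Type*} [MeasurableSpace Z] [Lattice Z] [TopologicalSpace Y]
    [OpensMeasurableSpace Y] [ClosedIicTopology Y] {μ : Measure ((X' × Z) × Y)} (h : IsCMTP2Set μ) :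
    IsCMTP2Set (μ.map (Prod.map Prod.fst id)) :=
  isCMTP2Set_map_prodMap h measurable_fst (fun _ _ => rfl) (fun _ _ => rfl) measurable_id
    (χ := id) GaloisConnection.id

/-- **Marginalisation in the second block, bounded dropped factor** ([FuchsWang2026] Cor. 2.4, `B' ⊆ B`): dropping a
factor `Z` with a top element from the conditioned block preserves (5.1) (`fst ⊣ (·, ⊤)`). [this work] -/
theorem isCMTP2Set_map_fst_right_of_orderTop {Z : Type*} [MeasurableSpace Z] [Lattice Z] [OrderTop Z]
    [TopologicalSpace Y'] [OpensMeasurableSpace Y'] [ClosedIicTopology Y'] {μ : Measure (X × (Y' × Z))}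
    (h : IsCMTP2Set μ) : IsCMTP2Set (μ.map (Prod.map id Prod.fst)) :=
  isCMTP2Set_map_prodMap h measurable_id (fun _ _ => rfl) (fun _ _ => rfl) measurable_fst
    (χ := fun y' => (y', ⊤)) fun _ _ => ⟨fun hp => ⟨hp, le_top⟩, fun hp => hp.1⟩

end Maps

section Replacement

variable {X' Z Y : Type*} [MeasurableSpace X'] [MeasurableSpace Z] [MeasurableSpace Y] [Lattice X'] [Lattice Z]
  [Lattice Y]

/-- **Replacement ([FuchsWang2026] Thm. 2.3, density-free)**: moving a sub-block `Z` from the conditioning block to the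
conditioned block preserves (5.1) — if the law of `((X', Z), Y)` satisfies `cMTP₂^set(Y | X', Z)` then the law of
`(X', (Z, Y))` satisfies `cMTP₂^set(Z, Y | X')`: the event `{X' ∈ C, (Z,Y) ≤ (z,y)}` is the old event for the
measurable set `C × (−∞,z]`, and `(C × (−∞,z]) ∧ (D × (−∞,z']) ⊆ (C ∧ D) × (−∞, z ∧ z']`.  In the paper this needs the
density `f_{X_A}` and Lemma A.1. [this work] -/
theorem isCMTP2Set_map_prodAssoc [TopologicalSpace Z] [OpensMeasurableSpace Z] [ClosedIicTopology Z]
    {μ : Measure ((X' × Z) × Y)} (h : IsCMTP2Set μ) :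
    IsCMTP2Set (μ.map (MeasurableEquiv.prodAssoc : (X' × Z) × Y ≃ᵐ X' × (Z × Y))) := by
  intro C D hC hD p q
  have hpre : ∀ (S : Set X') (r : Z × Y),
      (MeasurableEquiv.prodAssoc : (X' × Z) × Y ≃ᵐ X' × (Z × Y)) ⁻¹' (S ×ˢ Iic r) = (S ×ˢ Iic r.1) ×ˢ Iic r.2 := by
    intro S r
    ext x
    simp only [MeasurableEquiv.prodAssoc, MeasurableEquiv.coe_mk, Equiv.prodAssoc_apply, mem_preimage, mem_prod,
      mem_Iic, Prod.le_def, and_assoc]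
  rw [MeasurableEquiv.map_apply, MeasurableEquiv.map_apply, MeasurableEquiv.map_apply, MeasurableEquiv.map_apply,
    hpre, hpre, hpre, hpre]
  exact (h (hC.prod measurableSet_Iic) (hD.prod measurableSet_Iic) p.2 q.2).trans
    (mul_le_mul' (measure_mono (prod_mono (prod_Iic_infs_subset C D p.1 q.1) Subset.rfl))
      (measure_mono (prod_mono (prod_Iic_sups_subset C D p.1 q.1) Subset.rfl)))

/-- **Marginalisation in the second block along a cofinal sequence** ([FuchsWang2026] Cor. 2.4, `B' ⊆ B`; e.g. the
dropped factor is `ℝ^k`): `μ(C × ((−∞,y'] × Z)) = sup_n μ(C × (−∞,(y', s_n)])`. [this work] -/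
theorem isCMTP2Set_map_fst_right {Y' : Type*} [MeasurableSpace Y'] [Lattice Y'] [TopologicalSpace Y']
    [OpensMeasurableSpace Y'] [ClosedIicTopology Y'] {μ : Measure (X' × (Y' × Z))} (h : IsCMTP2Set μ)
    {s : ℕ → Z} (hs : Monotone s) (hcof : ∀ z, ∃ n, z ≤ s n) :
    IsCMTP2Set (μ.map (Prod.map id Prod.fst)) := by
  intro C D hC hD y₁ y₂
  have hm : Measurable (Prod.map (id : X' → X') (Prod.fst : Y' × Z → Y')) := measurable_id.prodMap measurable_fst
  have hpre : ∀ (S : Set X') (y' : Y'),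
      Prod.map (id : X' → X') (Prod.fst : Y' × Z → Y') ⁻¹' (S ×ˢ Iic y') = ⋃ n, S ×ˢ Iic (y', s n) := by
    intro S y'
    ext x
    simp only [mem_preimage, mem_prod, mem_Iic, Prod.map_fst, Prod.map_snd, id_eq, mem_iUnion, Prod.le_def]
    constructor
    · rintro ⟨hS, hy⟩
      obtain ⟨n, hn⟩ := hcof x.2.2
      exact ⟨n, hS, hy, hn⟩
    · rintro ⟨n, hS, hy, -⟩
      exact ⟨hS, hy⟩
  have hmono : ∀ (S : Set X') (y' : Y'), Monotone fun n => S ×ˢ Iic (y', s n) := fun S y' m n hmn =>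
    prod_mono Subset.rfl (Iic_subset_Iic.2 ⟨le_rfl, hs hmn⟩)
  rw [Measure.map_apply hm (hC.prod measurableSet_Iic), Measure.map_apply hm (hD.prod measurableSet_Iic), hpre, hpre]
  refine (measure_mul_le_of_monotone_iUnion μ (hmono C y₁) (hmono D y₂) (hmono (C ⊼ D) (y₁ ⊓ y₂))
    (hmono (C ⊻ D) (y₁ ⊔ y₂)) fun n => by
      simpa only [Prod.mk_inf_mk, Prod.mk_sup_mk, inf_idem, sup_idem] using h hC hD (y₁, s n) (y₂, s n)).trans ?_
  rw [← hpre, ← hpre]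
  exact mul_le_mul' (Measure.le_map_apply hm.aemeasurable _) (Measure.le_map_apply hm.aemeasurable _)

end Replacement

end Summit.CriticalPhenomena.PercolationContinuityZ3.Theorems.SahiCMTP2
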